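import Summits.CriticalPhenomena.PercolationContinuityZ3.Theorems.Transplant.FKDoubleFanMultifanForm
import HarnessLib

/-!
# Double fans, MULTIFAN₁ middles: the SIX GENERATOR BIVECTORS of a fan leg and the shape identities (endpoint layer of LEMMA‴, part 1)

Helper file (`--supports stmt-CriticalPhenomena-4575`), FK sub-lane `prim-bschramm-fk-3` (gen 35); builds on p205010 (kernel theorem, internal audit
signed; external expert review pending).  Pure real algebra, no sorries; standard axioms.  Memo `bschramm/prim-bschramm-fk-3/FAR-CROSS-X.md` §1.

By `…MultifanForm` the four-leg Rayleigh difference of a MULTIFAN₁ middle is `q²·pairH (target bivector of the b-fan G and s) (input bivector of the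
a-fan F and u)`, the input bivector being `wedgeH (fanCombo F (AC_1 ∗ u)) (fanCombo F u)`.  As a function of `u` it depends only on the six hat
products `P = uprods u` (`…OneSidedProducts`), linearly; as a function of the fan vector `F` it is quadratic, and at the three endpoint SHAPES of the
fan leg it collapses to SIX GENERATOR BIVECTORS, each linear in `P`:
* degenerate fan vector `(f₀, f_ab, 0, 0, 0)`:  `(f₀² + f₀f_ab) • genDg q P`  (`genDg = −N(P)·(a∧b)`, rank one: `∧²detach` has rank one),
* floor fan vector `(0, f_ab, f_ac, f_bc, f₁)`:  `f_ac(f_ac+f₁+f_bc) • genA P + f_bc(f_bc+f₁+f_ac) • genN q P + f_ac f_ab • genCone P + f_ab f_bc • genCtwo q P`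
  (the coefficients of `f_ab², f₁², f_ab f₁` vanish and those of `f_ac f₁`, `f_bc f₁`, `f_ac f_bc` are `genA`, `genN`, `genA + genN` EXACTLY — the
  bivector-level form of the structure `condA, condN, condC1, condC2` of `…OneSidedProducts`),
* roof fan vector `swapAC (swapAB (roofV q κ l t w))`:  `(κl) • genR q t w P` (homogeneous of degree one in `κ` and in `l`).
(**`wedgeH_fanCombo_deg/floor/roof`**.)  The target side is the MIRROR: with **`Biv.swapYZ`** (the hat relabelling `y ↔ z`, sign on `e_y∧e_z`) the
dressed target bivector `wedgeH (fanComboBrev G (s ∗ BC_1)) (fanComboBrev G s)` at the three shapes of the `b`-fan vector `G` (degenerate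
`(g₀,0,0,g_bc,0)`, floor `(0,g_ab,g_ac,g_bc,g₁)`, roof `swapAB (roofV q κ l t w)`) is the same combination of `swapYZ (genX (sprods s))`
(**`wedgeH_fanComboBrev_deg/floor/roof`**), and `pairH` is `swapYZ`-symmetric (**`pairH_swapYZ`**) — this is the mirror symmetry
`(F, G, u, s) ↔ (swapAC G, swapAC F, swapAB s, swapAB u)` of the four-leg form.  Finally the input and target bivectors are AFFINE along the `u`- and
`s`-fibres of the apex frames (**`wedgeH_fanCombo_ufibre`**, **`wedgeH_fanComboBrev_sfibre`**; the pinned vector `AC_1 ∗ u` does not see the fibre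
coordinate), so all four legs of LEMMA‴ satisfy the hypothesis `haff` of `vecB_nonneg_of_rays_gen`.
[folklore]
-/

noncomputable section

namespace Summit.CriticalPhenomena.PercolationContinuityZ3.Theorems

namespace FK

namespace ThreeApex

/-! ### The mirror on bivectors -/

/-- The hat relabelling `y ↔ z` on bivectors (coordinates `uy ↔ uz`, `xy ↔ xz`, `yv ↔ zv`, and `yz ↦ −yz`). [folklore] -/
def Biv.swapYZ (β : Biv) : Biv := ⟨β.ux, β.uz, β.uy, β.uv, β.xz, β.xy, β.xv, -β.yz, β.zv, β.yv⟩

/-- `pairH` is symmetric under the mirror: `⟪σβ, γ⟫ = ⟪σγ, β⟫`. [folklore] -/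
theorem pairH_swapYZ (q : ℝ) (β γ : Biv) : pairH q (Biv.swapYZ β) γ = pairH q (Biv.swapYZ γ) β := by
  simp only [pairH, Biv.swapYZ]; ring

/-- `swapYZ` is additive. [folklore] -/
theorem Biv.swapYZ_add (β γ : Biv) : Biv.swapYZ (Biv.add β γ) = Biv.add (Biv.swapYZ β) (Biv.swapYZ γ) := by
  ext
  all_goals simp only [Biv.swapYZ, Biv.add]
  ring

/-- `swapYZ` commutes with scalars. [folklore] -/
theorem Biv.swapYZ_smul (c : ℝ) (β : Biv) : Biv.swapYZ (Biv.smul c β) = Biv.smul c (Biv.swapYZ β) := by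
  ext
  all_goals simp only [Biv.swapYZ, Biv.smul]
  ring

/-! ### The six generator bivectors of the input side (functions of the product vector `P`) -/

/-- Generator `A`: the bare input bivector `ω(P) = (P_a û) ∧ û` itself (coefficient of `f_ac²`, `f_ac f₁`). [folklore] -/
def genA (P : P6) : Biv := ⟨0, -P.uy, 0, -P.uv, -P.xy, 0, -P.xv, P.yz, 0, -P.zv⟩

/-- Generator `N`: `−N(P)·e_y∧e_v` (coefficient of `f_bc²`, `f_bc f₁`), `N(P) = zv − (2−q)uv + (1−q)xy`. [folklore] -/
def genN (q : ℝ) (P : P6) : Biv := ⟨0, 0, 0, 0, 0, 0, 0, 0, (2 - q) * P.uv - (1 - q) * P.xy - P.zv, 0⟩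

/-- Generator `C1` (coefficient of `f_ac f_ab`). [folklore] -/
def genCone (P : P6) : Biv := ⟨P.xy - P.uv, -P.uy, P.yz - P.uy, -P.uv, -P.xy, P.zv - P.xy, -P.xv, P.yz, 0, -P.zv⟩

/-- Generator `C2` (coefficient of `f_ab f_bc`). [folklore] -/
def genCtwo (q : ℝ) (P : P6) : Biv :=
  ⟨0, P.yz - (2 - q) * P.uy, 0, -((1 - q) * P.xy), P.zv - (2 - q) * P.uv, 0, -((1 - q) * P.xv), (2 - q) * P.uy - P.yz,
    (2 - q) * P.uv - (1 - q) * P.xy - P.zv, -((1 - q) * P.xy)⟩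

/-- Generator `Dg` (degenerate fan vector): `−N(P)·(a∧b)`, `a∧b = e_ux + e_uv − e_xy − e_xz + e_yv + e_zv` the rank-one direction of `∧²detach`. [folklore] -/
def genDg (q : ℝ) (P : P6) : Biv :=
  ⟨(2 - q) * P.uv - (1 - q) * P.xy - P.zv, 0, 0, (2 - q) * P.uv - (1 - q) * P.xy - P.zv, -((2 - q) * P.uv - (1 - q) * P.xy - P.zv),
    -((2 - q) * P.uv - (1 - q) * P.xy - P.zv), 0, 0, (2 - q) * P.uv - (1 - q) * P.xy - P.zv, (2 - q) * P.uv - (1 - q) * P.xy - P.zv⟩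

set_option maxHeartbeats 2000000 in
/-- Generator `R` (roof fan vector with ratio `t` and tight probe `w`, per unit `κl`). [folklore] -/
def genR (q t w : ℝ) (P : P6) : Biv :=
  ⟨4 * P.uv * t ^ 2 - 2 * P.xy * t ^ 2 - 2 * P.zv * t ^ 2 - 4 * P.uv * q * t ^ 2 + P.uv * q ^ 2 * t ^ 2 + 2 * P.uv * t * w - 4 * P.uv * t * w ^ 2 + 3 * P.xy * q * t ^ 2 - P.xy * q ^ 2 * t ^ 2 + 2 * P.xy * t * w ^ 2 + P.zv * q * t ^ 2 - 2 * P.zv * t * w + 2 * P.zv * t * w ^ 2 + P.uv * q * t * w ^ 2 - P.xy * q * t * w ^ 2,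
    2 * P.uy * w - 4 * P.uy * w ^ 2 - 2 * P.yz * w + 2 * P.yz * w ^ 2 + P.uy * q * w ^ 2 + 2 * P.uy * t * w - 2 * P.yz * t * w - 3 * P.uy * q * t * w ^ 2 + P.uy * q ^ 2 * t * w ^ 2 + P.yz * q * t * w ^ 2,
    -2 * P.uy * t * w + 2 * P.yz * t * w + 2 * P.uy * q * t * w - P.uy * q * t * w ^ 2 - 2 * P.yz * q * t * w + P.yz * q * t * w ^ 2,
    4 * P.uv * t + 4 * P.uv * t ^ 2 + 2 * P.uv * w - 4 * P.uv * w ^ 2 - 2 * P.xy * t - 2 * P.xy * t ^ 2 - 2 * P.zv * t - 2 * P.zv * t ^ 2 - 2 * P.zv * w + 2 * P.zv * w ^ 2 - 4 * P.uv * q * t - 4 * P.uv * q * t ^ 2 + P.uv * q * w ^ 2 + P.uv * q ^ 2 * t + P.uv * q ^ 2 * t ^ 2 + 2 * P.uv * t * w - 4 * P.uv * t * w ^ 2 + 3 * P.xy * q * t + 3 * P.xy * q * t ^ 2 - P.xy * q ^ 2 * t - P.xy * q ^ 2 * t ^ 2 + 2 * P.xy * t * w ^ 2 + P.zv * q * t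 + P.zv * q * t ^ 2 - 2 * P.zv * t * w + 2 * P.zv * t * w ^ 2 + P.uv * q * t * w ^ 2 - 3 * P.xy * q * t * w ^ 2 + P.xy * q ^ 2 * t * w ^ 2,
    -4 * P.uv * t - 4 * P.uv * t ^ 2 + 2 * P.xy * t + 2 * P.xy * t ^ 2 - 2 * P.xy * w ^ 2 + 2 * P.zv * t + 2 * P.zv * t ^ 2 + 4 * P.uv * q * t + 4 * P.uv * q * t ^ 2 - P.uv * q ^ 2 * t - P.uv * q ^ 2 * t ^ 2 + 4 * P.uv * t * w ^ 2 - 3 * P.xy * q * t - 3 * P.xy * q * t ^ 2 + P.xy * q * w ^ 2 + P.xy * q ^ 2 * t + P.xy * q ^ 2 * t ^ 2 - 2 * P.xy * t * w ^ 2 - P.zv * q * t - P.zv * q * t ^ 2 - 2 * P.zv * t * w ^ 2 - 4 * P.uv * q * t * w ^ 2 + P.uv * q ^ 2 * t * w ^ 2 + P.xy * q * t * w ^ 2 + P.zv * q * t * w ^ 2,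
    -4 * P.uv * t ^ 2 + 2 * P.xy * t ^ 2 + 2 * P.zv * t ^ 2 + 4 * P.uv * q * t ^ 2 - P.uv * q ^ 2 * t ^ 2 - 4 * P.uv * t * w + 4 * P.uv * t * w ^ 2 - 3 * P.xy * q * t ^ 2 + P.xy * q ^ 2 * t ^ 2 - 2 * P.xy * t * w ^ 2 - P.zv * q * t ^ 2 + 4 * P.zv * t * w - 2 * P.zv * t * w ^ 2 + 2 * P.uv * q * t * w - 2 * P.uv * q * t * w ^ 2 + P.xy * q * t * w ^ 2 - 2 * P.zv * q * t * w + P.zv * q * t * w ^ 2,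
    -2 * P.xv * w ^ 2 + P.xv * q * w ^ 2 - 2 * P.xv * q * t * w ^ 2 + P.xv * q ^ 2 * t * w ^ 2,
    -4 * P.uy * w + 4 * P.uy * w ^ 2 + 4 * P.yz * w - 2 * P.yz * w ^ 2 + 2 * P.uy * q * w - 2 * P.uy * q * w ^ 2 - 4 * P.uy * t * w - 2 * P.yz * q * w + P.yz * q * w ^ 2 + 4 * P.yz * t * w + 2 * P.uy * q * t * w + 2 * P.uy * q * t * w ^ 2 - P.uy * q ^ 2 * t * w ^ 2 - 2 * P.yz * q * t * w,
    4 * P.uv - 2 * P.xy - 2 * P.zv - 4 * P.uv * q + P.uv * q ^ 2 + 8 * P.uv * t + 4 * P.uv * t ^ 2 - 4 * P.uv * w ^ 2 + 3 * P.xy * q - P.xy * q ^ 2 - 4 * P.xy * t - 2 * P.xy * t ^ 2 + 2 * P.xy * w ^ 2 + P.zv * q - 4 * P.zv * t - 2 * P.zv * t ^ 2 + 2 * P.zv * w ^ 2 - 8 * P.uv * q * t - 4 * P.uv * q * t ^ 2 + 4 * P.uv * q * w ^ 2 + 2 * P.uv * q ^ 2 * t + P.uv * q ^ 2 * t ^ 2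 - P.uv * q ^ 2 * w ^ 2 - 4 * P.uv * t * w ^ 2 + 6 * P.xy * q * t + 3 * P.xy * q * t ^ 2 - 3 * P.xy * q * w ^ 2 - 2 * P.xy * q ^ 2 * t - P.xy * q ^ 2 * t ^ 2 + P.xy * q ^ 2 * w ^ 2 + 2 * P.xy * t * w ^ 2 + 2 * P.zv * q * t + P.zv * q * t ^ 2 - P.zv * q * w ^ 2 + 2 * P.zv * t * w ^ 2 + 4 * P.uv * q * t * w ^ 2 - P.uv * q ^ 2 * t * w ^ 2 - 3 * P.xy * q * t * w ^ 2 + P.xy * q ^ 2 * t * w ^ 2 - P.zv * q * t * w ^ 2,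
    4 * P.uv * t + 4 * P.uv * t ^ 2 + 4 * P.uv * w - 4 * P.uv * w ^ 2 - 2 * P.xy * t - 2 * P.xy * t ^ 2 - 2 * P.zv * t - 2 * P.zv * t ^ 2 - 4 * P.zv * w + 2 * P.zv * w ^ 2 - 4 * P.uv * q * t - 4 * P.uv * q * t ^ 2 - 2 * P.uv * q * w + 2 * P.uv * q * w ^ 2 + P.uv * q ^ 2 * t + P.uv * q ^ 2 * t ^ 2 + 4 * P.uv * t * w - 4 * P.uv * t * w ^ 2 + 3 * P.xy * q * t + 3 * P.xy * q * t ^ 2 - P.xy * q ^ 2 * t - P.xy * q ^ 2 * t ^ 2 + 2 * P.xy * t * w ^ 2 + P.zv * q * t + P.zv * q * t ^ 2 + 2 * P.zv * q * w - P.zv * q * w ^ 2 - 4 * P.zv * t * w + 2 * P.zv * t * w ^ 2 - 2 * P.uv * q * t * w + 2 * P.uv * q * t * w ^ 2 - 3 * P.xy * q * t * w ^ 2 + P.xy * q ^ 2 * t * w ^ 2 + 2 * P.zv * q * t * w - P.zv * q * t * w ^ 2⟩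

/-! ### Shape identities, input side -/

/-- **Degenerate fan vector.** [folklore] -/
theorem wedgeH_fanCombo_deg (q f0 fab : ℝ) (u : V5) :
    wedgeH (fanCombo q ⟨f0, fab, 0, 0, 0⟩ (conv (edgeAC 1) u)) (fanCombo q ⟨f0, fab, 0, 0, 0⟩ u) =
      Biv.smul (f0 ^ 2 + f0 * fab) (genDg q (uprods u)) := by
  ext <;> simp only [wedgeH, fanCombo, conv, edgeAC, detach, V5.total, hx, hy, hz, uprods, genDg, Biv.smul] <;> ring

/-- **Floor fan vector.** [folklore] -/
theorem wedgeH_fanCombo_floor (q fab fac fbc f1 : ℝ) (u : V5) :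
    wedgeH (fanCombo q ⟨0, fab, fac, fbc, f1⟩ (conv (edgeAC 1) u)) (fanCombo q ⟨0, fab, fac, fbc, f1⟩ u) =
      Biv.add (Biv.add (Biv.smul (fac * (fac + f1 + fbc)) (genA (uprods u))) (Biv.smul (fbc * (fbc + f1 + fac)) (genN q (uprods u))))
        (Biv.add (Biv.smul (fac * fab) (genCone (uprods u))) (Biv.smul (fab * fbc) (genCtwo q (uprods u)))) := by
  ext <;> simp only [wedgeH, fanCombo, conv, edgeAC, detach, V5.total, hx, hy, hz, uprods, genA, genN, genCone, genCtwo, Biv.smul, Biv.add] <;> ring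

/-- **Roof fan vector.** [folklore] -/
theorem wedgeH_fanCombo_roof (q κ l t w : ℝ) (u : V5) :
    wedgeH (fanCombo q (swapAC (swapAB (roofV q κ l t w))) (conv (edgeAC 1) u)) (fanCombo q (swapAC (swapAB (roofV q κ l t w))) u) =
      Biv.smul (κ * l) (genR q t w (uprods u)) := by
  ext <;> simp only [wedgeH, fanCombo, conv, edgeAC, detach, V5.total, hx, hy, hz, uprods, genR, Biv.smul, swapAC, swapAB, roofV, vecB,
    xwR, zwR, u0R] <;> ring

/-! ### Shape identities, target side (the mirror) -/

/-- **Degenerate `b`-fan vector.** [folklore] -/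
theorem wedgeH_fanComboBrev_deg (q g0 gbc : ℝ) (s : V5) :
    wedgeH (fanComboBrev q ⟨g0, 0, 0, gbc, 0⟩ (conv s (edgeBC 1))) (fanComboBrev q ⟨g0, 0, 0, gbc, 0⟩ s) =
      Biv.smul (g0 ^ 2 + g0 * gbc) (Biv.swapYZ (genDg q (sprods s))) := by
  ext <;> simp only [wedgeH, fanComboBrev, conv, edgeBC, detach, V5.total, hx, hy, hz, sprods, genDg, Biv.smul, Biv.swapYZ] <;> ring

/-- **Floor `b`-fan vector.** [folklore] -/
theorem wedgeH_fanComboBrev_floor (q gab gac gbc g1 : ℝ) (s : V5) :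
    wedgeH (fanComboBrev q ⟨0, gab, gac, gbc, g1⟩ (conv s (edgeBC 1))) (fanComboBrev q ⟨0, gab, gac, gbc, g1⟩ s) =
      Biv.add (Biv.add (Biv.smul (gac * (gac + g1 + gab)) (Biv.swapYZ (genA (sprods s))))
          (Biv.smul (gab * (gab + g1 + gac)) (Biv.swapYZ (genN q (sprods s)))))
        (Biv.add (Biv.smul (gac * gbc) (Biv.swapYZ (genCone (sprods s)))) (Biv.smul (gab * gbc) (Biv.swapYZ (genCtwo q (sprods s))))) := by
  ext <;> simp only [wedgeH, fanComboBrev, conv, edgeBC, detach, V5.total, hx, hy, hz, sprods, genA, genN, genCone, genCtwo, Biv.smul, Biv.add,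
    Biv.swapYZ] <;> ring

/-- **Roof `b`-fan vector.** [folklore] -/
theorem wedgeH_fanComboBrev_roof (q κ l t w : ℝ) (s : V5) :
    wedgeH (fanComboBrev q (swapAB (roofV q κ l t w)) (conv s (edgeBC 1))) (fanComboBrev q (swapAB (roofV q κ l t w)) s) =
      Biv.smul (κ * l) (Biv.swapYZ (genR q t w (sprods s))) := by
  ext <;> simp only [wedgeH, fanComboBrev, conv, edgeBC, detach, V5.total, hx, hy, hz, sprods, genR, Biv.smul, Biv.swapYZ, swapAB, roofV, vecB,
    xwR, zwR, u0R] <;> ring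

/-! ### Fibre-affinity of the `u`- and `s`-legs -/

/-- The pinned input does not see the `u`-fibre coordinate. [folklore] -/
theorem conv_edgeAC_one_vecB (q W y X Z a b : ℝ) : conv (edgeAC 1) (vecB q W y X Z a) = conv (edgeAC 1) (vecB q W y X Z b) := by
  ext <;> simp only [conv, edgeAC, vecB, V5.total] <;> ring

/-- **The dressed input bivector is affine along the `u`-fibre** (`u = vecB q W y X Z u₀`, `u₀ ↦ c·a + (1−c)·b`). [folklore] -/
theorem wedgeH_fanCombo_ufibre (q : ℝ) (F : V5) (W y X Z a b c : ℝ) :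
    wedgeH (fanCombo q F (conv (edgeAC 1) (vecB q W y X Z (c * a + (1 - c) * b)))) (fanCombo q F (vecB q W y X Z (c * a + (1 - c) * b))) =
      Biv.lin3 c (wedgeH (fanCombo q F (conv (edgeAC 1) (vecB q W y X Z a))) (fanCombo q F (vecB q W y X Z a)))
        (1 - c) (wedgeH (fanCombo q F (conv (edgeAC 1) (vecB q W y X Z b))) (fanCombo q F (vecB q W y X Z b))) 0 (wedgeH F F) := by
  ext <;> simp only [wedgeH, fanCombo, conv, edgeAC, detach, vecB, V5.total, hx, hy, hz, Biv.lin3, Biv.add, Biv.smul] <;> ring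

/-- **The dressed target bivector is affine along the `s`-fibre** (`s = swapAB (vecB q W y X Z s₀)`). [folklore] -/
theorem wedgeH_fanComboBrev_sfibre (q : ℝ) (G : V5) (W y X Z a b c : ℝ) :
    wedgeH (fanComboBrev q G (conv (swapAB (vecB q W y X Z (c * a + (1 - c) * b))) (edgeBC 1)))
        (fanComboBrev q G (swapAB (vecB q W y X Z (c * a + (1 - c) * b)))) =
      Biv.lin3 c (wedgeH (fanComboBrev q G (conv (swapAB (vecB q W y X Z a)) (edgeBC 1))) (fanComboBrev q G (swapAB (vecB q W y X Z a))))
        (1 - c) (wedgeH (fanComboBrev q G (conv (swapAB (vecB q W y X Z b)) (edgeBC 1))) (fanComboBrev q G (swapAB (vecB q W y X Z b))))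
        0 (wedgeH G G) := by
  ext <;> simp only [wedgeH, fanComboBrev, conv, edgeBC, detach, vecB, swapAB, V5.total, hx, hy, hz, Biv.lin3, Biv.add, Biv.smul] <;> ring

/-- **The four-leg Rayleigh difference is affine along the `u`-fibre.** [folklore] -/
theorem mfRayleigh_fibreU_affine (q : ℝ) (F G s : V5) (W y X Z a b c : ℝ) :
    (fun u : V5 => mfZ q F G u s 1 0 * mfZ q F G u s 0 1 - mfZ q F G u s 1 1 * mfZ q F G u s 0 0) (vecB q W y X Z (c * a + (1 - c) * b)) =
      c * (fun u : V5 => mfZ q F G u s 1 0 * mfZ q F G u s 0 1 - mfZ q F G u s 1 1 * mfZ q F G u s 0 0) (vecB q W y X Z a) +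
      (1 - c) * (fun u : V5 => mfZ q F G u s 1 0 * mfZ q F G u s 0 1 - mfZ q F G u s 1 1 * mfZ q F G u s 0 0) (vecB q W y X Z b) := by
  simp only [mfZ_rayleigh_eq_pairH, wedgeH_fanCombo_ufibre q F W y X Z a b c, pairH_comm_lin3]
  ring

/-- **The four-leg Rayleigh difference is affine along the `s`-fibre.** [folklore] -/
theorem mfRayleigh_fibreS_affine (q : ℝ) (F G u : V5) (W y X Z a b c : ℝ) :
    (fun s : V5 => mfZ q F G u s 1 0 * mfZ q F G u s 0 1 - mfZ q F G u s 1 1 * mfZ q F G u s 0 0) (swapAB (vecB q W y X Z (c * a + (1 - c) * b))) =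
      c * (fun s : V5 => mfZ q F G u s 1 0 * mfZ q F G u s 0 1 - mfZ q F G u s 1 1 * mfZ q F G u s 0 0) (swapAB (vecB q W y X Z a)) +
      (1 - c) * (fun s : V5 => mfZ q F G u s 1 0 * mfZ q F G u s 0 1 - mfZ q F G u s 1 1 * mfZ q F G u s 0 0) (swapAB (vecB q W y X Z b)) := by
  simp only [mfZ_rayleigh_eq_pairH, wedgeH_fanComboBrev_sfibre q G W y X Z a b c, pairH_lin3]
  ring

end ThreeApex

end FK

end Summit.CriticalPhenomena.PercolationContinuityZ3.Theorems
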